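import Summits.BirchSwinnertonDyer.BirchSwinnertonDyer.Theorems.RamifiedSevenEllipticUnitsValueOfKMCImpReading
import Literature.NumberTheory.EllipticCurves.Kato2004.PerrinRiouRatio
import Summits.BirchSwinnertonDyer.Rank1Residual.Additive.KatoDescentClosedBindersContra
import Summits.BirchSwinnertonDyer.Rank1Residual.Additive.KatoDescentKMCImpReadingRowRealizable
import Summits.BirchSwinnertonDyer.Rank1Residual.Additive.KatoDescentKMCImpReadingIsogenyClass
import Summits.BirchSwinnertonDyer.Rank1Residual.Additive.KatoDescentRankOneCountRowsOfLoc
import Summits.BirchSwinnertonDyer.Rank1Residual.Additive.KatoDescentRealizableContraRankOne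
import Literature.NumberTheory.EllipticCurves.Kato2004.KatoMainConjectureCMOffMu
import Summits.BirchSwinnertonDyer.Rank1Residual.Additive.KatoDescentLengthEqualityOffMuClassCSeven
import Literature.NumberTheory.EllipticCurves.Kato2004.IwasawaH1FreeOfNoRationalTorsionProofs
import Literature.NumberTheory.EllipticCurves.Wuthrich2014.ShaBoundProofs
import Literature.NumberTheory.EllipticCurves.IsogenyIdProofs
import Mathlib.RingTheory.Ideal.Height
import HarnessLib

/-!
# Crux idea sketch `kato-member-transport` — crux `EllipticUnitValueSevenOfGZK`
# (item stmt-BirchSwinnertonDyer-19945), line of record `Lines/kato_perrin_riou_zp.lean` v8,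
# target stub `stub_existsAdmissibleSeven` (2a)

Planner `bsd-idea-20` g51 (crux-ideate; NOT a skeleton, NOT registered; the line of record is untouched).
Typed signatures accompanying the crux idea card `Ideas/kato-member-transport.md`:

* `AdmissibleAt W`            — the conclusion of `stub_existsAdmissibleSeven` at ONE curve `W` (verbatim shape);
* `ExistsAdmissibleMemberSeven` — the proposed RESHAPED stub 2a′: every `W ∈ 𝒞₇` is `ℚ`-isogenous to a
                                 globally minimal member of `𝒞₇` at which `AdmissibleAt` holds (intended witness:
                                 Kato's member `W_K`, `T₇W_K ≅ V_{ℤ₇}(f_W)(1)`, which EXISTS by the tree theorem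
                                 `WeierstrassCurve.exists_isIsogenous_isGloballyMinimal_tateModule_equiv_of_stableLattice`);
* `HeightOneDescent`          — FIRST LEMMA (pure commutative algebra): in a finite free module over `Λ = ℤ_p⟦T⟧`
                                 a divisibility `L ∣ r•y` that holds after localisation at every height-one prime
                                 holds globally (Λ is a UFD / Krull domain; free modules are reflexive);
* `EndMoveByCassels`          — the END MOVE: if BSD(·,p) is proved at the members satisfying a predicate `P` and every
                                 class of `𝒞₇` has a `P`-member, Cassels' isogeny invariance (`bsdRHS_eq_of_isIsogenous`,
                                 consumed through `Wuthrich2014.bsdp_of_isIsogenous`) gives the leaf `X12.CMRamifiedSeven`.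

Nothing here asserts anything about Kato's objects; every decl is a `Prop`-valued definition (no `sorry`, no axiom).
-/

set_option linter.dupNamespace false
set_option autoImplicit false

noncomputable section

open scoped Classical NumberField

open WeierstrassCurve Literature.NumberTheory.EllipticCurves
open Literature.NumberTheory.EllipticCurves.Rank1Residual
open Literature.NumberTheory.EllipticCurves.Rank1Residual.Typed
open Literature.NumberTheory.EllipticCurves.IwasawaAlgebra
open Literature.NumberTheory.EllipticCurves.Kato2004
open Summit.BirchSwinnertonDyer.Rank1Residual
open Summit.BirchSwinnertonDyer.Rank1Residual.Additive
open Summit.BirchSwinnertonDyer.BirchSwinnertonDyer.Theses.RamifiedSevenEllipticUnits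
open Summit.BirchSwinnertonDyer.BirchSwinnertonDyer.Theorems.RamifiedSevenEllipticUnits

namespace Summit.BirchSwinnertonDyer.BirchSwinnertonDyer.Cruxes.EllipticUnitValueSevenOfGZK.KatoMemberTransport

universe u

/-- The conclusion of `stub_existsAdmissibleSeven` at one curve: an admissible class EXISTS in some strict
`Δ`-trivial Iwasawa cohomology datum of `T₇W` over the cyclotomic `ℤ₇`-tower (position clause (A6′):
`(7^{(−e)⁺}·M̃) • z₀ = (u·7^{e⁺}) • 𝐲`). -/
def AdmissibleAt (W : WeierstrassCurve ℚ) [W.IsElliptic] [W.IsGloballyMinimal] [Fact (Nat.Prime 7)] : Prop :=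
  letI : ContinuousSMul ℤ_[7] (W.tateModule 7) := TateModule.continuousSMul_padicInt
  ∃ (K : ZpExtension ℚ 7) (hK : K.IsCyclotomic) (γ : Field.absoluteGaloisGroup ℚ) (_ : K.IsTopGenerator γ)
    (I : IwasawaH1Data W 7 K γ) (z₀ : I.H), Kato2004.IsAdmissibleZetaClass W 7 K hK I z₀

/-- Stub 2a as registered (for comparison): `AdmissibleAt` at EVERY member of `𝒞₇`. -/
def StubTwoA : Prop :=
  ∀ (W : WeierstrassCurve ℚ) [W.IsElliptic] [W.IsGloballyMinimal] [Fact (Nat.Prime 7)],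
    X12.ClassCSeven W → AdmissibleAt W

/-- **Proposed reshaped stub 2a′ (predicted TRUE; print-by-proof + one tree theorem):** every `W ∈ 𝒞₇` is
`ℚ`-isogenous to a globally minimal member of `𝒞₇` (closure: `X12.ClassCSeven.of_isIsogenous`) at which an
admissible class exists — intended witness Kato's member `W_K` (`T₇W_K ≅ V_{ℤ₇}(f_W)(1)`; exists by
`WeierstrassCurve.exists_isIsogenous_isGloballyMinimal_tateModule_equiv_of_stableLattice`), where integrality of
`𝐳_γ` is Kato 13.12 (height-one primes `≠ (7)`) + 13.6/13.10(2) (the prime `(7)`) + 13.14, and the strict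
`Δ`-trivial `𝐇¹_Γ(T₇W_K)` is `Λ`-FREE because `W_K(ℚ)[7] = 0` (`IwasawaH1Data.moduleFree_of_torsionBy_eq_bot`). -/
def ExistsAdmissibleMemberSeven : Prop :=
  ∀ (W : WeierstrassCurve ℚ) [W.IsElliptic] [W.IsGloballyMinimal] [Fact (Nat.Prime 7)],
    X12.ClassCSeven W →
      ∃ (W' : WeierstrassCurve ℚ) (_ : W'.IsElliptic) (_ : W'.IsGloballyMinimal),
        IsIsogenous W W' ∧ X12.ClassCSeven W' ∧ AdmissibleAt W'

/-- Trivially `2a ⟹ 2a′` (take `W' = W`). -/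
theorem existsAdmissibleMemberSeven_of_stubTwoA (h : StubTwoA) : ExistsAdmissibleMemberSeven := by
  intro W _ _ _ hW
  exact ⟨W, inferInstance, inferInstance, isIsogenous_self W, hW, h W hW⟩

/-- **FIRST LEMMA (height-one descent of a divisibility in a free `Λ`-module; pure algebra).**
`Λ = ℤ_p⟦T⟧` is a two-dimensional regular local ring, hence a UFD; in a finite free `Λ`-module `M ≅ Λⁿ` the
equation `L • z = r • y` (`L ≠ 0`) is solvable iff it is solvable coordinatewise iff for every height-one prime `𝔮`
it is solvable after inverting some `s ∉ 𝔮` (`⋂_{ht 𝔮 = 1} Λ_𝔮 = Λ`).  This is the frame in which the position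
clause (A6′) is decided prime by prime: distinguished primes (Kato 13.12: parameter variation) and `𝔮 = (p)`
(the `μ`-part: Kato 13.6 + 13.10(2) at Kato's lattice; lattice-dependent otherwise). -/
def HeightOneDescent : Prop :=
  ∀ (p : ℕ) [Fact p.Prime] (M : Type u) [AddCommGroup M] [Module (IwasawaAlgebra p) M]
    [Module.Free (IwasawaAlgebra p) M] [Module.Finite (IwasawaAlgebra p) M]
    (L r : IwasawaAlgebra p) (y : M), L ≠ 0 →
    (∀ 𝔮 : PrimeSpectrum (IwasawaAlgebra p), Ideal.height 𝔮.asIdeal = 1 →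
        ∃ s : IwasawaAlgebra p, s ∉ 𝔮.asIdeal ∧ ∃ z : M, L • z = (s * r) • y) →
    ∃ z₀ : M, L • z₀ = r • y

/-- **END MOVE (Cassels transport of the leaf from the `P`-members).**  For ANY predicate `P` on curves (intended:
"is Kato's member of its isogeny class"): Cassels' invariance of the BSD quotient under isogeny (named fact
`bsdRHS_eq_of_isIsogenous`, consumed via `Wuthrich2014.bsdp_of_isIsogenous`) moves `BSD(W',p)` from a `P`-member
`W'` to every `W ∼_ℚ W'`; if every class of `𝒞₇` has a `P`-member this yields the leaf `X12.CMRamifiedSeven`.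
(The `Finite Ш` / `leadingLCoeff ≠ 0` side conditions are the ones `bsdp_of_isIsogenous` asks for.) -/
def EndMoveByCassels : Prop :=
  ∀ (P : WeierstrassCurve ℚ → Prop),
    bsdRHS_eq_of_isIsogenous →
    (∀ (W : WeierstrassCurve ℚ) [W.IsElliptic] [W.IsGloballyMinimal], X12.ClassCSeven W → P W →
        Finite W.sha ∧ W.leadingLCoeff ≠ 0 ∧ ∀ p : ℕ, p.Prime → BSDp W p) →
    (∀ (W : WeierstrassCurve ℚ) [W.IsElliptic] [W.IsGloballyMinimal], X12.ClassCSeven W →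
        ∃ (W' : WeierstrassCurve ℚ) (_ : W'.IsElliptic) (_ : W'.IsGloballyMinimal), IsIsogenous W W' ∧ P W') →
    X12.CMRamifiedSeven

/-- The end move HOLDS (kernel; a few lines over `Wuthrich2014.bsdp_of_isIsogenous` and
`X12.ClassCSeven.of_isIsogenous`). -/
theorem endMoveByCassels_holds : EndMoveByCassels := by
  intro P hCassels hP hmem W _ _ hW p hp
  obtain ⟨W', hW'e, hW'm, hiso, hPW'⟩ := hmem W hW
  haveI := hW'e; haveI := hW'm
  haveI : Fact p.Prime := ⟨hp⟩
  obtain ⟨hfin', hlead', hbsd'⟩ := hP W' (X12.ClassCSeven.of_isIsogenous hiso hW) hPW'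
  exact Wuthrich2014.bsdp_of_isIsogenous hCassels hiso hfin' hlead' (hbsd' p hp)

end Summit.BirchSwinnertonDyer.BirchSwinnertonDyer.Cruxes.EllipticUnitValueSevenOfGZK.KatoMemberTransport

end
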